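import Summits.QuantumFields.YangMills.Theorems.UnitScaleTiltFluctuationComparisonRegPrApproxLift

/-!
# Route `UnitScaleTilt` — crux K1bR-pr `FluctuationComparisonRegPr` (stmt-QuantumFields-19201), stub `stub_oneStepSmallLift`
# (W7 line), step 3′: the approximate-lift reduction WITH A FIRST-ORDER DEFECT OF SMALL COEFFICIENT
# (support file `--supports stmt-QuantumFields-19201`)

Cell `ym3-torus` (rung R3), seat `ym3-torus-p2` gen 8.  `…ApproxLift.oneStepSmallLift_stub_of_approx` reduces the registered stub to
approximate one-step lifts whose averaging defect is SECOND order, `C·δ²`.  For block sizes `L ≥ 5` the natural closed-form linear lift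
(the canonical Whitney lift sharpened by `B⁻¹ = (β⁻¹)^{⊗3}`, IR-NODE §13.2: norm `8L⁴/(L²+1)³ < L^{-1/2}` iff `L ≥ 5`) has an
INFINITE-radius kernel with geometric tails (ratio `((3L²+1) − 2L√(2(L²+1)))/(L²−1) < 3 − 2√2`), so a LOCAL (finite-radius) covariant
realisation truncates it and leaves a defect that is FIRST order in `δ` with a coefficient `η₁` as small as one likes (radius `↑`).  The
middle-bond repair absorbs such a defect at the price `8·|I|·η₁` in the gain.  This file records that variant of the reduction:

* `ApproxSmallLiftLin F κ₀ η₁ C δ₀`: approximate lifts with gain `κ₀` and defect `η₁·δ + C·δ²`;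
* `oneStepSmallLift_of_approxLin`: `OneStepSmallLift F ℰp (κ₀ + 8|I|η₁ + 8|I|Cδ₁) δ₁` for `δ₁` small (explicit conditions), `|I| = 36L³`;
* `oneStepSmallLift_stub_of_approxLin`: the REGISTERED SIGNATURE of `stub_oneStepSmallLift` from
  `∀ L, ∃ κ₀ η₁ C δ₀, … (κ₀ + 8·(36L³)·η₁)·√L < 1 … ∀ F, F.L = L → ApproxSmallLiftLin F κ₀ η₁ C δ₀`;
* `approxSmallLiftLin_of_approxSmallLift`: the second-order schema is the case `η₁ = 0`.

Elementary bookkeeping over the landed engine; nothing of Bałaban's is asserted.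
-/

noncomputable section

open scoped RealInnerProductSpace Quaternion NNReal Matrix.Norms.L2Operator

namespace Summit.QuantumFields.YangMills.Theorems.ApproxLift

open Literature.MathematicalPhysics.QuantumFieldTheory.Balaban1983to89
open Literature.MathematicalPhysics.QuantumFieldTheory.Balaban1983to89.T4Continuum
open Literature.MathematicalPhysics.QuantumFieldTheory.Balaban1983to89.AveragingRT
open Literature.MathematicalPhysics.QuantumFieldTheory.Balaban1983to89.BlockAveraging
open Literature.MathematicalPhysics.QuantumFieldTheory.Balaban1983to89.T3ContinuumYM3Torus
open Literature.MathematicalPhysics.QuantumFieldTheory.Balaban1983to89.T3UnitLawDensityEML (ℰp)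
open Literature.MathematicalPhysics.QuantumFieldTheory.Balaban1983to89.T3SmallLiftHistory
open Summit.QuantumFields.YangMills.Theorems.MiddleBondRepair

/-- **APPROXIMATE SMALL LIFTS WITH A FIRST-ORDER DEFECT** (hypothesis schema): every run `K`, level `j` in the standing range and radius
`δ ∈ (0, δ₀]` admits approximate one-step lifts with gain `κ₀` and accuracy `η₁·δ + C·δ²`. -/
def ApproxSmallLiftLin (F : T3Family) (κ₀ η₁ C δ₀ : ℝ) : Prop :=
  ∀ K j : ℕ, j + 1 ≤ (F.P K).m + (F.P K).K → ∀ δ : ℝ, 0 < δ → δ ≤ δ₀ →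
    ApproxLiftStep (F.P K) j κ₀ (η₁ * δ + C * δ ^ 2) δ

/-- The second-order schema is the case `η₁ = 0` of the first-order one. -/
theorem approxSmallLiftLin_of_approxSmallLift {F : T3Family} {κ₀ C δ₀ : ℝ} (h : ApproxSmallLift F κ₀ C δ₀) :
    ApproxSmallLiftLin F κ₀ 0 C δ₀ := by
  intro K j hj δ hδ hδ₀
  have := h K j hj δ hδ hδ₀
  simpa [zero_mul, zero_add] using this

/-- **`OneStepSmallLift ⇐ ApproxSmallLiftLin`** with an explicit loss in the gain: for `δ₁ ≤ δ₀` small enough (depending on `L`, `κ₀`,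
`η₁`, `C` only) the family admits EXACT one-step lifts at all radii `≤ δ₁` with gain `κ₀ + 8·|I|·η₁ + 8·|I|·C·δ₁`, `|I| = 36L³`. -/
theorem oneStepSmallLift_of_approxLin (F : T3Family) {κ₀ η₁ C δ₀ δ₁ : ℝ} (hκ₀ : 0 ≤ κ₀) (hη₁ : 0 ≤ η₁) (hC : 0 ≤ C)
    (hδ₁ : 0 < δ₁) (hδ₁₀ : δ₁ ≤ δ₀) (hδ₁1 : δ₁ ≤ 1)
    (hδ₁s : (((5 * F.L : ℕ) : ℝ)) ^ 2 / 4 * (κ₀ * δ₁) ≤ rhoU (36 * F.L ^ 3))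
    (hδ₁a : (η₁ + C) * δ₁ ≤ rhoU (36 * F.L ^ 3) / (2 * (36 * F.L ^ 3 : ℕ)))
    (h : ApproxSmallLiftLin F κ₀ η₁ C δ₀) :
    OneStepSmallLift F ℰp (κ₀ + 8 * (36 * F.L ^ 3 : ℕ) * η₁ + 8 * (36 * F.L ^ 3 : ℕ) * C * δ₁) δ₁ := by
  intro K j hj δ hδ hδδ₁
  have hn : Fintype.card (Idx (F.P K)) = 36 * F.L ^ 3 := BlockAvgCorrector.card_idx_T3 F K
  have happ := h K j hj δ hδ (hδδ₁.trans hδ₁₀)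
  have hδ1 : δ ≤ 1 := hδδ₁.trans hδ₁1
  have hsq : δ ^ 2 ≤ δ₁ * δ := by rw [sq]; exact mul_le_mul_of_nonneg_right hδδ₁ hδ.le
  have hsq' : δ ^ 2 ≤ δ₁ := by nlinarith [hsq, hδ1, hδ₁.le]
  refine smallLiftStep_of_approx hj hκ₀ hδ.le (by positivity) ?_ ?_ ?_ happ
  · rw [hn]
    calc η₁ * δ + C * δ ^ 2 ≤ η₁ * δ₁ + C * δ₁ := by
          have h1 := mul_le_mul_of_nonneg_left hδδ₁ hη₁
          have h2 := mul_le_mul_of_nonneg_left hsq' hC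
          linarith
      _ = (η₁ + C) * δ₁ := by ring
      _ ≤ _ := hδ₁a
  · rw [hn, stokes_family]
    exact (mul_le_mul_of_nonneg_left (mul_le_mul_of_nonneg_left hδδ₁ hκ₀) (by positivity)).trans hδ₁s
  · rw [hn]
    have hN : (0 : ℝ) ≤ 8 * ((36 * F.L ^ 3 : ℕ) : ℝ) := by positivity
    have h1 : 8 * ((36 * F.L ^ 3 : ℕ) : ℝ) * (C * δ ^ 2) ≤ 8 * ((36 * F.L ^ 3 : ℕ) : ℝ) * C * δ₁ * δ := by
      calc 8 * ((36 * F.L ^ 3 : ℕ) : ℝ) * (C * δ ^ 2) = (8 * ((36 * F.L ^ 3 : ℕ) : ℝ) * C) * δ ^ 2 := by ring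
        _ ≤ (8 * ((36 * F.L ^ 3 : ℕ) : ℝ) * C) * (δ₁ * δ) := mul_le_mul_of_nonneg_left hsq (by positivity)
        _ = 8 * ((36 * F.L ^ 3 : ℕ) : ℝ) * C * δ₁ * δ := by ring
    calc κ₀ * δ + 8 * ((36 * F.L ^ 3 : ℕ) : ℝ) * (η₁ * δ + C * δ ^ 2)
        = κ₀ * δ + 8 * ((36 * F.L ^ 3 : ℕ) : ℝ) * η₁ * δ + 8 * ((36 * F.L ^ 3 : ℕ) : ℝ) * (C * δ ^ 2) := by ring
      _ ≤ κ₀ * δ + 8 * ((36 * F.L ^ 3 : ℕ) : ℝ) * η₁ * δ + 8 * ((36 * F.L ^ 3 : ℕ) : ℝ) * C * δ₁ * δ := by linarith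
      _ = (κ₀ + 8 * ((36 * F.L ^ 3 : ℕ) : ℝ) * η₁ + 8 * ((36 * F.L ^ 3 : ℕ) : ℝ) * C * δ₁) * δ := by ring

/-- **THE REGISTERED STUB'S SHAPE FROM FIRST-ORDER-DEFECT APPROXIMATE LIFTS**: if for every block size `L` there are `κ₀, η₁ ≥ 0` with
`(κ₀ + 8·(36L³)·η₁)·√L < 1` (STRICT), `C ≥ 0` and `δ₀ > 0` such that every family with `F.L = L` has `ApproxSmallLiftLin F κ₀ η₁ C δ₀`,
then the registered signature of `stub_oneStepSmallLift` holds verbatim. -/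
theorem oneStepSmallLift_stub_of_approxLin
    (h : ∀ L : ℕ, ∃ κ₀ η₁ C δ₀ : ℝ, 0 ≤ κ₀ ∧ 0 ≤ η₁ ∧ (κ₀ + 8 * (36 * L ^ 3 : ℕ) * η₁) * Real.sqrt L < 1 ∧ 0 ≤ C ∧ 0 < δ₀ ∧
      ∀ F : T3Family, F.L = L → ApproxSmallLiftLin F κ₀ η₁ C δ₀) :
    ∀ L : ℕ, ∃ κ δ₀ : ℝ, κ * Real.sqrt L ≤ 1 ∧ 0 < δ₀ ∧ ∀ F : T3Family, F.L = L → OneStepSmallLift F ℰp κ δ₀ := by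
  intro L
  obtain ⟨κ₀, η₁, C, δ₀, hκ₀, hη₁, hκL, hC, hδ₀, hF⟩ := h L
  set n : ℕ := 36 * L ^ 3 with hn_def
  set ρ : ℝ := rhoU n with hρ_def
  have hρ : 0 < ρ := rhoU_pos n
  set sL : ℝ := Real.sqrt L with hsL
  have hsL0 : 0 ≤ sL := Real.sqrt_nonneg _
  set κ₁ : ℝ := κ₀ + 8 * (n : ℝ) * η₁ with hκ₁_def
  have hκ₁0 : 0 ≤ κ₁ := by positivity
  have hgap : 0 < 1 - κ₁ * sL := by linarith
  set A₁ : ℝ := (((5 * L : ℕ) : ℝ)) ^ 2 / 4 * κ₀ + 1 with hA₁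
  set A₂ : ℝ := 2 * (n : ℝ) * (η₁ + C) + 1 with hA₂
  set A₃ : ℝ := 8 * (n : ℝ) * C * sL + 1 with hA₃
  have hA₁pos : 0 < A₁ := by positivity
  have hA₂pos : 0 < A₂ := by positivity
  have hA₃pos : 0 < A₃ := by positivity
  set δ₁ : ℝ := min (min δ₀ 1) (min (min (ρ / A₁) (ρ / A₂)) ((1 - κ₁ * sL) / A₃)) with hδ₁_def
  have hδ₁pos : 0 < δ₁ := by positivity
  have hδ₁₀ : δ₁ ≤ δ₀ := (min_le_left _ _).trans (min_le_left _ _)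
  have hδ₁1 : δ₁ ≤ 1 := (min_le_left _ _).trans (min_le_right _ _)
  have hδ₁A₁ : δ₁ ≤ ρ / A₁ := (min_le_right _ _).trans ((min_le_left _ _).trans (min_le_left _ _))
  have hδ₁A₂ : δ₁ ≤ ρ / A₂ := (min_le_right _ _).trans ((min_le_left _ _).trans (min_le_right _ _))
  have hδ₁A₃ : δ₁ ≤ (1 - κ₁ * sL) / A₃ := (min_le_right _ _).trans (min_le_right _ _)
  refine ⟨κ₁ + 8 * (n : ℝ) * C * δ₁, δ₁, ?_, hδ₁pos, fun F hFL => ?_⟩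
  · have h1 : 8 * (n : ℝ) * C * δ₁ * sL ≤ 1 - κ₁ * sL := by
      have := (le_div_iff₀ hA₃pos).mp hδ₁A₃
      nlinarith [this, hδ₁pos.le, hsL0, hC]
    nlinarith [h1]
  · subst hFL
    have hn' : (36 * F.L ^ 3 : ℕ) = n := rfl
    have h1 : (((5 * F.L : ℕ) : ℝ)) ^ 2 / 4 * (κ₀ * δ₁) ≤ rhoU (36 * F.L ^ 3) := by
      rw [hn']
      have := (le_div_iff₀ hA₁pos).mp hδ₁A₁
      nlinarith [this, hδ₁pos.le, hκ₀]
    have h2 : (η₁ + C) * δ₁ ≤ rhoU (36 * F.L ^ 3) / (2 * (36 * F.L ^ 3 : ℕ)) := by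
      rw [hn']
      have hn0 : (0 : ℝ) < n := by
        rw [hn_def]; have := F.hL.2; positivity
      have := (le_div_iff₀ hA₂pos).mp hδ₁A₂
      rw [le_div_iff₀ (by positivity)]
      nlinarith [this, hδ₁pos.le, hC, hη₁]
    have h3 := oneStepSmallLift_of_approxLin F hκ₀ hη₁ hC hδ₁pos hδ₁₀ hδ₁1 h1 h2 (hF F rfl)
    rw [hn'] at h3
    exact h3

end Summit.QuantumFields.YangMills.Theorems.ApproxLift

end
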